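import Mathlib
import Summits.Ventures.PercRepro2.HCov
import Summits.Ventures.PercRepro2.HCovCubic
import Summits.Ventures.PercRepro2.TriDisagreement
import Summits.Ventures.PercRepro2.TriDisagreementPinned
import Summits.Ventures.PercRepro2.TypedSplit
import Summits.Ventures.PercRepro2.OneTypedEdge
import Summits.Ventures.PercRepro2.StarPattern
import Summits.Ventures.PercRepro2.StarIdentities
import Summits.Ventures.PercRepro2.TypedSeries
import Summits.Ventures.PercRepro2.StarDebt
import Summits.Ventures.PercRepro2.StarPairsBone
import Summits.Ventures.PercRepro2.StarPairs
import Summits.Ventures.PercRepro2.StarPairsTwo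

/-!
# The `(2,2,1)` debt identity (blind cell PercRepro2, p1 g12; the third orientation of
`StarDebt.lean`, the one LEAD-CCW (c⁗⁗⁗) quotes: «N_(2,2,1) = B(01₂) + B(T₁ + 01₁) + B(01₁ + 02₁) +
B(01₁ + 12₁) − B(T₁)»)

With `s₁, s₂` of type `2` and `s₃` of type `1` (labels `0, 1, 2`), the star identity reads
`N_(2,2,1) + B(T₁) = B(01₁, 02₁) + B(01₁, T₁) + B(01₂) + B(01₁, 12₁)` (**`star_221`**), so the hard
step at this star is `B(T₁) ≤ B(01₁, 02₁) + B(01₁, T₁) + B(01₂) + B(01₁, 12₁)` (**`HardStep221`**,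
`typedCount_221_nonneg_iff`); and in typed counts of the graph (`StarPairs*.lean`): `N_(2,2,1) = E(T;01) +
N(s₁ open; s₂ s₃ type 1) + N(s₂ open; s₁ type 2) + N(s₂ open; s₁ s₃ type 1)` (**`star_221_graph`**), so NPM at
this star is an inequality inside the graph row (**`npm_01_iff_graph`**). Identities only.
-/

namespace Summit.Ventures.PercRepro2

open CovForm CovForm.OneTyped CovForm.TypedRed

namespace StarPattern

section Split

variable {V : Type*} {E : Type*} [Fintype E] [DecidableEq E] {R : Type*} [Field R]

/-- The split with types `(2, 2, 1)`. -/
theorem typedCount_star_split_221 (ends : E → Sym2 V) (o a₁ a₂ a₃ b : V) {s₁ s₂ s₃ : E}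
    (h12 : s₁ ≠ s₂) (h13 : s₁ ≠ s₃) (h23 : s₂ ≠ s₃) (F : Finset E) (hs₁ : s₁ ∈ F) (hs₂ : s₂ ∈ F)
    (hs₃ : s₃ ∈ F) (z : Config E) (τ : E → ℕ) (hτ₁ : τ s₁ = 2) (hτ₂ : τ s₂ = 2) (hτ₃ : τ s₃ = 1) :
    typedCount F z τ (K3 ends o a₁ a₂ a₃ b : Config E → Config E → Config E → R) =
      ∑ p₁ ∈ placements2, ∑ p₂ ∈ placements2, ∑ p₃ ∈ placements,
        patCount ends o a₁ a₂ a₃ b s₁ s₂ s₃ (((F.erase s₁).erase s₂).erase s₃)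
          (Function.update (Function.update (Function.update z s₁ false) s₂ false) s₃ false) τ
          (p₁.1, p₂.1, p₃.1) (p₁.2.1, p₂.2.1, p₃.2.1) (p₁.2.2, p₂.2.2, p₃.2.2) := by
  have hs₂' : s₂ ∈ F.erase s₁ := Finset.mem_erase.mpr ⟨h12.symm, hs₂⟩
  have hs₃' : s₃ ∈ (F.erase s₁).erase s₂ :=
    Finset.mem_erase.mpr ⟨h23.symm, Finset.mem_erase.mpr ⟨h13.symm, hs₃⟩⟩
  rw [typedCount_split F s₁ hs₁ z τ]
  simp only [hτ₁, sum_bool3_two]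
  simp only [typedCount_split (F.erase s₁) s₂ hs₂', hτ₂, sum_bool3_two]
  simp only [typedCount_split ((F.erase s₁).erase s₂) s₃ hs₃', hτ₃, sum_bool3_one]
  simp only [sum_placements, sum_placements2]
  unfold patCount patKernel starSet
  simp only []

end Split

section Debt

variable {V : Type*} {E : Type*} [Fintype E] [DecidableEq E] {R : Type*} [Field R]
  {ends : E → Sym2 V} {o a₁ a₂ a₃ b : V} {s₁ s₂ s₃ : E} {y u₁ u₂ u₃ : V}

/-- **The `(2,2,1)` debt identity**: `N_(2,2,1) + B(T₁) = B(01₁,02₁) + B(01₁,T₁) + B(01₂) + B(01₁,12₁)`. -/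
theorem star_221 (F : Finset E) (z : Config E) (τ : E → ℕ)
    (D : StarData ends o a₁ a₂ a₃ b s₁ s₂ s₃ y u₁ u₂ u₃ (((F.erase s₁).erase s₂).erase s₃)
      (Function.update (Function.update (Function.update z s₁ false) s₂ false) s₃ false))
    (hs₁ : s₁ ∈ F) (hs₂ : s₂ ∈ F) (hs₃ : s₃ ∈ F) (hτ₁ : τ s₁ = 2) (hτ₂ : τ s₂ = 2)
    (hτ₃ : τ s₃ = 1) :
    typedCount F z τ (K3 ends o a₁ a₂ a₃ b : Config E → Config E → Config E → R) +
      Bone ends o a₁ a₂ a₃ b s₁ s₂ s₃ (((F.erase s₁).erase s₂).erase s₃)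
        (Function.update (Function.update (Function.update z s₁ false) s₂ false) s₃ false) τ
        (true, true, true) =
      Btwo ends o a₁ a₂ a₃ b s₁ s₂ s₃ (((F.erase s₁).erase s₂).erase s₃)
        (Function.update (Function.update (Function.update z s₁ false) s₂ false) s₃ false) τ
        (true, true, false) (true, false, true) +
      Btwo ends o a₁ a₂ a₃ b s₁ s₂ s₃ (((F.erase s₁).erase s₂).erase s₃)
        (Function.update (Function.update (Function.update z s₁ false) s₂ false) s₃ false) τ
        (true, true, false) (true, true, true) +
      Btype2 ends o a₁ a₂ a₃ b s₁ s₂ s₃ (((F.erase s₁).erase s₂).erase s₃)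
        (Function.update (Function.update (Function.update z s₁ false) s₂ false) s₃ false) τ
        (true, true, false) +
      Btwo ends o a₁ a₂ a₃ b s₁ s₂ s₃ (((F.erase s₁).erase s₂).erase s₃)
        (Function.update (Function.update (Function.update z s₁ false) s₂ false) s₃ false) τ
        (true, true, false) (false, true, true) := by
  rw [typedCount_star_split_221 ends o a₁ a₂ a₃ b D.h12 D.h13 D.h23 F hs₁ hs₂ hs₃ z τ hτ₁ hτ₂ hτ₃]
  simp only [sum_placements, sum_placements2]
  simp only [patCount_close_x D τ (Or.inl rfl), patCount_close_x D τ (Or.inr (Or.inl rfl)),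
    patCount_close_x D τ (Or.inr (Or.inr rfl)), patCount_close_y D τ _ (Or.inl rfl),
    patCount_close_y D τ _ (Or.inr (Or.inl rfl)), patCount_close_y D τ _ (Or.inr (Or.inr rfl)),
    patCount_close_w D τ _ _ (Or.inl rfl), patCount_close_w D τ _ _ (Or.inr (Or.inl rfl)),
    patCount_close_w D τ _ _ (Or.inr (Or.inr rfl))]
  unfold Bone Btwo Btype2
  simp only [orU, Bool.or_true, Bool.or_false]
  ring

end Debt

section HardStep

variable {V : Type*} {E : Type*} [Fintype E] [DecidableEq E] {R : Type*} [Field R] [LinearOrder R]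
  {ends : E → Sym2 V} {o a₁ a₂ a₃ b : V} {s₁ s₂ s₃ : E}

/-- **The located hard step at a `(2,2,1)` star**: the four bases dominate the debt `B(T₁)`.
SCOPE (NEG-108): conjectured for the one-rung-down objects of GRAPHS — `(F₀, z₀, τ)` the typed
edges of `G − y`, `G` a finite graph (unmarked vertices allowed), the blocks the pieces of THIS star —
and for the five-mark base; NOT for typed hypergraphs with unmarked vertices (`H*`: `N = −2`). -/
def HardStep221 (ends : E → Sym2 V) (o a₁ a₂ a₃ b : V) (s₁ s₂ s₃ : E) (F₀ : Finset E)
    (z₀ : Config E) (τ : E → ℕ) : Prop :=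
  Bone (R := R) ends o a₁ a₂ a₃ b s₁ s₂ s₃ F₀ z₀ τ (true, true, true) ≤
    Btwo ends o a₁ a₂ a₃ b s₁ s₂ s₃ F₀ z₀ τ (true, true, false) (true, false, true) +
    Btwo ends o a₁ a₂ a₃ b s₁ s₂ s₃ F₀ z₀ τ (true, true, false) (true, true, true) +
    Btype2 ends o a₁ a₂ a₃ b s₁ s₂ s₃ F₀ z₀ τ (true, true, false) +
    Btwo ends o a₁ a₂ a₃ b s₁ s₂ s₃ F₀ z₀ τ (true, true, false) (false, true, true)

variable [IsStrictOrderedRing R] {y u₁ u₂ u₃ : V}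

/-- **2′TRI at a `(2,2,1)` star IS the hard step.** -/
theorem typedCount_221_nonneg_iff (F : Finset E) (z : Config E) (τ : E → ℕ)
    (D : StarData ends o a₁ a₂ a₃ b s₁ s₂ s₃ y u₁ u₂ u₃ (((F.erase s₁).erase s₂).erase s₃)
      (Function.update (Function.update (Function.update z s₁ false) s₂ false) s₃ false))
    (hs₁ : s₁ ∈ F) (hs₂ : s₂ ∈ F) (hs₃ : s₃ ∈ F) (hτ₁ : τ s₁ = 2) (hτ₂ : τ s₂ = 2)
    (hτ₃ : τ s₃ = 1) :
    0 ≤ typedCount F z τ (K3 ends o a₁ a₂ a₃ b : Config E → Config E → Config E → R) ↔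
      HardStep221 (R := R) ends o a₁ a₂ a₃ b s₁ s₂ s₃ (((F.erase s₁).erase s₂).erase s₃)
        (Function.update (Function.update (Function.update z s₁ false) s₂ false) s₃ false) τ := by
  have h := star_221 (R := R) F z τ D hs₁ hs₂ hs₃ hτ₁ hτ₂ hτ₃
  unfold HardStep221
  constructor
  · intro h0; linarith
  · intro h0; linarith

end HardStep

section Graph

variable {V : Type*} {E : Type*} [Fintype E] [DecidableEq E] {R : Type*} [Field R]
  {ends : E → Sym2 V} {o a₁ a₂ a₃ b : V} {s₁ s₂ s₃ : E} {y u₁ u₂ u₃ : V}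

/-- **The `(2,2,1)` star in typed counts of the graph**: `N_(2,2,1) = E(T;01) + N(s₁ open; s₂, s₃ of
type 1) + N(s₂ open; s₁ of type 2) + N(s₂ open; s₁, s₃ of type 1)`. -/
theorem star_221_graph (F : Finset E) (z : Config E) (τ : E → ℕ)
    (D : StarData ends o a₁ a₂ a₃ b s₁ s₂ s₃ y u₁ u₂ u₃ (((F.erase s₁).erase s₂).erase s₃)
      (Function.update (Function.update (Function.update z s₁ false) s₂ false) s₃ false))
    (hs₁ : s₁ ∈ F) (hs₂ : s₂ ∈ F) (hs₃ : s₃ ∈ F) (hτ₁ : τ s₁ = 2) (hτ₂ : τ s₂ = 2)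
    (hτ₃ : τ s₃ = 1) :
    typedCount F z τ (K3 ends o a₁ a₂ a₃ b : Config E → Config E → Config E → R) =
      (Btwo ends o a₁ a₂ a₃ b s₁ s₂ s₃ (((F.erase s₁).erase s₂).erase s₃)
        (Function.update (Function.update (Function.update z s₁ false) s₂ false) s₃ false) τ
        (true, true, false) (true, true, true) -
      Bone ends o a₁ a₂ a₃ b s₁ s₂ s₃ (((F.erase s₁).erase s₂).erase s₃)
        (Function.update (Function.update (Function.update z s₁ false) s₂ false) s₃ false) τ
        (true, true, true)) +
      typedCount (insert s₂ (insert s₃ (((F.erase s₁).erase s₂).erase s₃)))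
        (Function.update (Function.update (Function.update (Function.update z s₁ false) s₂ false)
          s₃ false) s₁ true)
        (Function.update (Function.update τ s₃ 1) s₂ 1) (K3 ends o a₁ a₂ a₃ b) +
      typedCount (insert s₁ (((F.erase s₁).erase s₂).erase s₃))
        (Function.update (Function.update (Function.update (Function.update z s₁ false) s₂ false)
          s₃ false) s₂ true)
        (Function.update τ s₁ 2) (K3 ends o a₁ a₂ a₃ b) +
      typedCount (insert s₁ (insert s₃ (((F.erase s₁).erase s₂).erase s₃)))
        (Function.update (Function.update (Function.update (Function.update z s₁ false) s₂ false)
          s₃ false) s₂ true)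
        (Function.update (Function.update τ s₃ 1) s₁ 1) (K3 ends o a₁ a₂ a₃ b) := by
  have hz₁ : Function.update (Function.update (Function.update z s₁ false) s₂ false) s₃ false s₁ =
      false := by
    rw [Function.update_of_ne D.h13, Function.update_of_ne D.h12, Function.update_self]
  have hz₂ : Function.update (Function.update (Function.update z s₁ false) s₂ false) s₃ false s₂ =
      false := by
    rw [Function.update_of_ne D.h23, Function.update_self]
  have hz₃ : Function.update (Function.update (Function.update z s₁ false) s₂ false) s₃ false s₃ =
      false := Function.update_self _ _ _
  have h := star_221 (R := R) F z τ D hs₁ hs₂ hs₃ hτ₁ hτ₂ hτ₃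
  rw [Btwo_01_02_eq_typedCount D τ hz₁ hz₂ hz₃, Btype2_01_eq_typedCount D τ hz₁ hz₂ hz₃,
    Btwo_01_12_eq_typedCount D τ hz₁ hz₂ hz₃]
  linear_combination h

end Graph

section NPM

variable {V : Type*} {E : Type*} [Fintype E] [DecidableEq E] {R : Type*} [Field R] [LinearOrder R]
  [IsStrictOrderedRing R] {ends : E → Sym2 V} {o a₁ a₂ a₃ b : V} {s₁ s₂ s₃ : E} {y u₁ u₂ u₃ : V}

/-- **NPM at a `(2,2,1)` star is an inequality inside the graph row**: `B(T₁) ≤ B(01₁, T₁)` iff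
`N(s₁ open; s₂ s₃ type 1) + N(s₂ open; s₁ type 2) + N(s₂ open; s₁ s₃ type 1) ≤ N_(2,2,1)(G)`. -/
theorem npm_01_iff_graph (F : Finset E) (z : Config E) (τ : E → ℕ)
    (D : StarData ends o a₁ a₂ a₃ b s₁ s₂ s₃ y u₁ u₂ u₃ (((F.erase s₁).erase s₂).erase s₃)
      (Function.update (Function.update (Function.update z s₁ false) s₂ false) s₃ false))
    (hs₁ : s₁ ∈ F) (hs₂ : s₂ ∈ F) (hs₃ : s₃ ∈ F) (hτ₁ : τ s₁ = 2) (hτ₂ : τ s₂ = 2)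
    (hτ₃ : τ s₃ = 1) :
    Bone (R := R) ends o a₁ a₂ a₃ b s₁ s₂ s₃ (((F.erase s₁).erase s₂).erase s₃)
        (Function.update (Function.update (Function.update z s₁ false) s₂ false) s₃ false) τ
        (true, true, true) ≤
      Btwo ends o a₁ a₂ a₃ b s₁ s₂ s₃ (((F.erase s₁).erase s₂).erase s₃)
        (Function.update (Function.update (Function.update z s₁ false) s₂ false) s₃ false) τ
        (true, true, false) (true, true, true) ↔
    typedCount (insert s₂ (insert s₃ (((F.erase s₁).erase s₂).erase s₃)))
        (Function.update (Function.update (Function.update (Function.update z s₁ false) s₂ false)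
          s₃ false) s₁ true)
        (Function.update (Function.update τ s₃ 1) s₂ 1)
        (K3 ends o a₁ a₂ a₃ b : Config E → Config E → Config E → R) +
      typedCount (insert s₁ (((F.erase s₁).erase s₂).erase s₃))
        (Function.update (Function.update (Function.update (Function.update z s₁ false) s₂ false)
          s₃ false) s₂ true)
        (Function.update τ s₁ 2) (K3 ends o a₁ a₂ a₃ b) +
      typedCount (insert s₁ (insert s₃ (((F.erase s₁).erase s₂).erase s₃)))
        (Function.update (Function.update (Function.update (Function.update z s₁ false) s₂ false)
          s₃ false) s₂ true)
        (Function.update (Function.update τ s₃ 1) s₁ 1) (K3 ends o a₁ a₂ a₃ b) ≤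
      typedCount F z τ (K3 ends o a₁ a₂ a₃ b) := by
  have h := star_221_graph (R := R) F z τ D hs₁ hs₂ hs₃ hτ₁ hτ₂ hτ₃
  constructor
  · intro h1; linarith
  · intro h1; linarith

end NPM

end StarPattern

end Summit.Ventures.PercRepro2
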